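import Mathlib.Combinatorics.Enumerative.DoubleCounting
import Mathlib.Data.Finset.Powerset
import Mathlib.Data.Nat.Choose.Basic
import Mathlib.Algebra.Order.BigOperators.Group.Finset
import Mathlib.Tactic
import HarnessLib

/-!
# Subsets meeting every member of a family of small sets in few points (first-moment / union bound)

Topic `Literature/Combinatorics/SetFamily`.  The union bound over the `f`-element subsets of a
ground set `S` ("the basic method", [AlonSpencer2016, Ch. 1]): a fixed `(d+1)`-element set lies in
exactly `C(|S| − (d+1), f − (d+1))` of the `C(|S|, f)` subsets of size `f`; a set `m` meeting `S` in
at most `D` points contains at most `C(D, d+1)` such `(d+1)`-sets; hence if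
`#family · C(D, d+1) · C(|S| − (d+1), f − (d+1)) < C(|S|, f)` some `f`-subset `F ⊆ S` meets
EVERY member of the family in at most `d` points.  Equivalently (for `d + 1 ≤ f ≤ |S|`, by
`C(n,f)·C(f,j) = C(n,j)·C(n−j,f−j)`): `#family · C(D, d+1) · C(f, d+1) < C(|S|, d+1)`, i.e. roughly
`#family · C(D,d+1) · (f/|S|)^{d+1} < 1`.

* `card_powersetCard_superset_le` — the `f`-subsets of `S` containing a fixed `T` inject into the
  `(f − |T|)`-subsets of `S ∖ T`.
* `exists_subset_forall_card_inter_le` — the existence statement above (double counting over the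
  pairs `(F, m)` with `|m ∩ F| ≥ d + 1`; no probability).
* `exists_subset_forall_card_inter_le'` — the same under the hypothesis
  `#family · C(D, d+1) · C(f, d+1) < C(|S|, d+1)`, `d + 1 ≤ f ≤ |S|`.

Provenance: this is the counting lemma `exists_lowdeg_subset` of the cell qa-qnc0 (planner file
`HOME/qa-qnc0-p1/exp33/LowDegSubset33.lean`, g33, "JPD at degree d", ROUND-32 §6 ADDENDUM 4), whose
proof is reproduced here essentially verbatim in the Literature namespace so that it can be combined
with `Literature.Computability.MetaComplexity.TwoModuli.norm_sum_le_of_monoSum_meet_le`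
(fixing the variables outside `F`, an `𝔽₂`-polynomial with these monomials has degree `≤ d` in the
`F`-variables).  The statement is elementary and not tied to that application.

## References
* [AlonSpencer2016] N. Alon, J. H. Spencer, *The Probabilistic Method*, 4th ed., Wiley 2016, Ch. 1
  ("The Basic Method": union bound / first moment over a uniformly random object) — the instance for
  uniformly random `f`-subsets is supplied here.
-/

namespace Literature.Combinatorics.SetFamily

open Finset

variable {α ι : Type*} [DecidableEq α]

/-- The `f`-subsets of `S` containing a fixed `T ⊆ S`… more precisely: `F ↦ F ∖ T` injects the
`f`-subsets of `S` that contain `T` into the `(f − |T|)`-subsets of `S ∖ T`, so there are at most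
`C(|S ∖ T|, f − |T|)` of them.
[cite: AlonSpencer2016, Ch. 1 «The Basic Method» (counting the f-sets through a fixed set) — this instance supplied here] -/
theorem card_powersetCard_superset_le (S T : Finset α) (f : ℕ) :
    ((S.powersetCard f).filter fun F => T ⊆ F).card ≤ ((S \ T).card).choose (f - T.card) := by
  rw [← card_powersetCard (f - T.card) (S \ T)]
  refine card_le_card_of_injOn (fun F => F \ T) (fun F hF => ?_) (fun F hF F' hF' h => ?_)
  · rw [mem_coe, mem_filter, mem_powersetCard] at hF
    rw [mem_coe, mem_powersetCard]
    exact ⟨sdiff_subset_sdiff hF.1.1 le_rfl, by rw [card_sdiff_of_subset hF.2, hF.1.2]⟩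
  · rw [mem_coe, mem_filter] at hF hF'
    have h' : F \ T = F' \ T := h
    have e : F \ T ∪ T = F' \ T ∪ T := by rw [h']
    rwa [sdiff_union_of_subset hF.2, sdiff_union_of_subset hF'.2] at e

/-- **Subsets meeting every member of a family in at most `d` points exist (union bound).**  Let
`m j` (`j ∈ mons`) be sets each meeting `S` in at most `D` points.  If
`#mons · C(D, d+1) · C(|S| − (d+1), f − (d+1)) < C(|S|, f)`, then some `F ⊆ S` with `|F| = f`
satisfies `|m j ∩ F| ≤ d` for every `j ∈ mons`.  Proof: otherwise every `f`-subset `F` of `S` has a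
member `m j` with `|m j ∩ F| ≥ d + 1`, hence contains one of the `≤ C(D, d+1)` `(d+1)`-subsets of
`m j ∩ S`; double counting the pairs `(F, j)` against `card_powersetCard_superset_le` contradicts the
hypothesis.
[cite: AlonSpencer2016, Ch. 1 «The Basic Method» (union bound over a uniformly random f-subset) — this instance supplied here] -/
theorem exists_subset_forall_card_inter_le (S : Finset α) (mons : Finset ι) (m : ι → Finset α)
    (D d f : ℕ) (hD : ∀ j ∈ mons, (m j ∩ S).card ≤ D)
    (hcount : mons.card * D.choose (d + 1) * (S.card - (d + 1)).choose (f - (d + 1))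
      < S.card.choose f) :
    ∃ F ⊆ S, F.card = f ∧ ∀ j ∈ mons, (m j ∩ F).card ≤ d := by
  by_contra hno
  push Not at hno
  set 𝓕 := S.powersetCard f with h𝓕
  -- every `F ∈ 𝓕` has a bad member
  have hbad : ∀ F ∈ 𝓕, 1 ≤ (mons.filter fun j => d + 1 ≤ (m j ∩ F).card).card := by
    intro F hF
    rw [mem_powersetCard] at hF
    obtain ⟨j, hj, hlt⟩ := hno F hF.1 hF.2
    exact card_pos.2 ⟨j, mem_filter.2 ⟨hj, by omega⟩⟩
  have h1 : 𝓕.card ≤ ∑ F ∈ 𝓕, (mons.filter fun j => d + 1 ≤ (m j ∩ F).card).card := by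
    calc 𝓕.card = ∑ F ∈ 𝓕, 1 := by simp
      _ ≤ _ := sum_le_sum hbad
  -- double counting
  have h2 : ∑ F ∈ 𝓕, (mons.filter fun j => d + 1 ≤ (m j ∩ F).card).card
      = ∑ j ∈ mons, (𝓕.filter fun F => d + 1 ≤ (m j ∩ F).card).card :=
    sum_card_bipartiteAbove_eq_sum_card_bipartiteBelow (fun F j => d + 1 ≤ (m j ∩ F).card)
  -- per member
  have h3 : ∀ j ∈ mons, (𝓕.filter fun F => d + 1 ≤ (m j ∩ F).card).card
      ≤ D.choose (d + 1) * (S.card - (d + 1)).choose (f - (d + 1)) := by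
    intro j hj
    have hcover : (𝓕.filter fun F => d + 1 ≤ (m j ∩ F).card)
        ⊆ ((m j ∩ S).powersetCard (d + 1)).biUnion fun T => 𝓕.filter fun F => T ⊆ F := by
      intro F hF
      rw [mem_filter, mem_powersetCard] at hF
      obtain ⟨T, hT, hTcard⟩ := exists_subset_card_eq hF.2
      rw [mem_biUnion]
      refine ⟨T, mem_powersetCard.2 ⟨fun a ha => ?_, hTcard⟩,
        mem_filter.2 ⟨mem_powersetCard.2 hF.1, fun a ha => (mem_inter.1 (hT ha)).2⟩⟩
      exact mem_inter.2 ⟨(mem_inter.1 (hT ha)).1, hF.1.1 (mem_inter.1 (hT ha)).2⟩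
    refine (card_le_card hcover).trans (card_biUnion_le.trans ?_)
    calc ∑ T ∈ (m j ∩ S).powersetCard (d + 1), (𝓕.filter fun F => T ⊆ F).card
        ≤ ∑ _T ∈ (m j ∩ S).powersetCard (d + 1), (S.card - (d + 1)).choose (f - (d + 1)) := by
          refine sum_le_sum fun T hT => ?_
          rw [mem_powersetCard] at hT
          have hTS : T ⊆ S := fun a ha => (mem_inter.1 (hT.1 ha)).2
          have := card_powersetCard_superset_le S T f
          rwa [card_sdiff_of_subset hTS, hT.2] at this
      _ = ((m j ∩ S).card.choose (d + 1)) * (S.card - (d + 1)).choose (f - (d + 1)) := by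
          rw [sum_const, card_powersetCard, smul_eq_mul]
      _ ≤ D.choose (d + 1) * (S.card - (d + 1)).choose (f - (d + 1)) :=
          Nat.mul_le_mul_right _ (Nat.choose_le_choose _ (hD j hj))
  have h4 : ∑ j ∈ mons, (𝓕.filter fun F => d + 1 ≤ (m j ∩ F).card).card
      ≤ mons.card * (D.choose (d + 1) * (S.card - (d + 1)).choose (f - (d + 1))) := by
    rw [← smul_eq_mul, ← sum_const]
    exact sum_le_sum h3
  have h5 : 𝓕.card = S.card.choose f := card_powersetCard _ _
  have : S.card.choose f
      ≤ mons.card * D.choose (d + 1) * (S.card - (d + 1)).choose (f - (d + 1)) := by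
    rw [mul_assoc, ← h5]; exact h1.trans (h2 ▸ h4)
  omega

/-- **The same, with the hypothesis in the form `#mons · C(D, d+1) · C(f, d+1) < C(|S|, d+1)`**
(for `d + 1 ≤ f ≤ |S|`; by `C(n, f)·C(f, j) = C(n, j)·C(n − j, f − j)`, `Nat.choose_mul`) — i.e.
roughly `#mons · C(D, d+1) · (f/|S|)^{d+1} < 1`.
[cite: AlonSpencer2016, Ch. 1 «The Basic Method» (union bound over a uniformly random f-subset) — this instance supplied here] -/
theorem exists_subset_forall_card_inter_le' (S : Finset α) (mons : Finset ι) (m : ι → Finset α)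
    (D d f : ℕ) (hD : ∀ j ∈ mons, (m j ∩ S).card ≤ D) (hdf : d + 1 ≤ f) (hfS : f ≤ S.card)
    (hcount : mons.card * D.choose (d + 1) * f.choose (d + 1) < S.card.choose (d + 1)) :
    ∃ F ⊆ S, F.card = f ∧ ∀ j ∈ mons, (m j ∩ F).card ≤ d := by
  refine exists_subset_forall_card_inter_le S mons m D d f hD ?_
  -- `C(|S|, f) · C(f, d+1) = C(|S|, d+1) · C(|S| − (d+1), f − (d+1))`
  have hmul : S.card.choose f * f.choose (d + 1)
      = S.card.choose (d + 1) * (S.card - (d + 1)).choose (f - (d + 1)) := Nat.choose_mul hdf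
  have hpos : 0 < (S.card - (d + 1)).choose (f - (d + 1)) :=
    Nat.choose_pos (Nat.sub_le_sub_right hfS _)
  have hfpos : 0 < f.choose (d + 1) := Nat.choose_pos hdf
  by_contra hle
  push Not at hle
  -- multiply the failed inequality by `C(f, d+1)` and cancel `C(|S| − (d+1), f − (d+1))`
  have h1 : S.card.choose (d + 1) * (S.card - (d + 1)).choose (f - (d + 1))
      ≤ (mons.card * D.choose (d + 1) * f.choose (d + 1)) * (S.card - (d + 1)).choose (f - (d + 1)) := by
    calc S.card.choose (d + 1) * (S.card - (d + 1)).choose (f - (d + 1))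
        = S.card.choose f * f.choose (d + 1) := hmul.symm
      _ ≤ (mons.card * D.choose (d + 1) * (S.card - (d + 1)).choose (f - (d + 1))) * f.choose (d + 1) :=
          Nat.mul_le_mul_right _ hle
      _ = (mons.card * D.choose (d + 1) * f.choose (d + 1)) * (S.card - (d + 1)).choose (f - (d + 1)) := by
          ring
  have h2 : S.card.choose (d + 1) ≤ mons.card * D.choose (d + 1) * f.choose (d + 1) :=
    Nat.le_of_mul_le_mul_right h1 hpos
  exact absurd hcount (not_lt.mpr h2)

end Literature.Combinatorics.SetFamily
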